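import Literature.NumberTheory.Rogawski1990.CohomologicalFinComponentIsTheta        -- ★ the (C♭)-telescope vocabulary of the REL text (`rhoAtLine`, `locF`, cotangency at `ι`)
import Summits.HodgeConjecture.CorCM.B01.Transposition.Item6OmegaChiSplitting      -- ★ `isCompatible_chiSplittingLine` (REL text)
import Literature.NumberTheory.Rogawski1990.CohDiscreteMemXiFamilyArchPinned        -- ★ D6 `MemXiFamily` (ED. 4: the print letter #80 S2♯ `cohDiscrete_memXiFamily_archPinned` is NO LONGER used by this file)
import Summits.HodgeConjecture.HodgeConjecture.Theorems.F0P3MemXiFamilyTransfer    -- ★ `exists_muOmega` (Rogawski's auxiliary `μ`, Hewitt–Ross)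
import Summits.HodgeConjecture.HodgeConjecture.Theorems.F0P2rFamTransferHolds     -- ★ p842415 F0P2-p01 (g10): FAM-TR `stubRelFamTransfer_holds` — stub CLOSED BY NAME (edition v1.1 «FAM-TR FOLD»)
import Summits.HodgeConjecture.HodgeConjecture.Theorems.F0P2rCuspDictHolds        -- ★ p842892 F0P2-p01 (g10): CUSP-DICT `stubCuspDict_holds` — stub CLOSED BY NAME (edition v1.2 «CUSP-DICT FOLD»)
import Summits.HodgeConjecture.HodgeConjecture.Theorems.F0P2uS2SharpTheta        -- ED. 4: ★ p845234 (F0P2-p01 (g13) FILE 4 over ★ FILE 1∕2 F0P2-p06 (g9) + ★ FILE 3 F0P2-p01 (g13)): S2♯-θ `stubS2sharpTheta_holds` — stub CLOSED BY NAME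
import HarnessLib

/-!
# Crux `H413` · programme P2 · REL¹ ⟸ REL♯¹ — the E2 `F0_P2E3RelEngine` §3 head re-hosted at Theorems level, hypothesis form

Cell hodgecm-mathlib (D-0151), FLOOR 0, crux item H413 = stmt-HodgeConjecture-24833; route support item `F0HdictE` = stmt-HodgeConjecture-27455 (programme P2).
Author: desk F0P2-plan (g14), 2026-09-01 — REPORT-FIRST CANDIDATE (a P2 pen files it `--supports stmt-HodgeConjecture-24833 --as helper`; kernel lane).
THEOREMS ONLY (no `def`, no instance, no local attribute, no notation, no named fact of our own, no `sorry`); never imports a `Cruxes/…/Lines` module (O50-1) —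
every statement text below is SLICED from the tree Lines bytes named per item (python, never retyped) and every in-house input is plugged BY NAME.
HONEST LABEL: HC_CM is proved only modulo the printed citations until rung 0 closes.  This file adds NO mathematics: it re-hosts, at `Theorems/` level and in HYPOTHESIS FORM, a kernel-checked Lines head, so that on the day
the hypothesis closes the fold is ONE token and NO Lines→Lines import is ever needed (the END-GAME fold chain of PLAN-P2 v16 §3).

* `relOne_of_relSharpOne (hRS : ‹REL♯¹›) : ‹REL¹›` — hypothesis = `F0P2E3RelEngine.StubRelSharpParityOne` (tree `Cruxes/H413/Lines/F0_P2E3RelEngine.lean` ED. 4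
  sha16 4a580e9da1b3cd0a :292 ff., the ONE registered `sorry` of E2, books #162′-side «(C4)» REL♯¹; = conclusion text of ★ `F0P3RelParityOfT5.relSharpGuardedOneMeasure_of_T5`);
  conclusion = `F0P2E3RelEngine.RelTarget` (:164 ff.) = `F0P2E3RelSign.StubE3FlatRelParityOne` (tree E1 ED. 4 sha16 f803733e6fbc6c36 :216 ff.; ws-normalised sha16 tie asserted by the generator);
  proof = the body of E2's kernel-checked head `relParity_of_engine` with S2♯-θ ↦ ★ p845234 `F0P2uS2SharpTheta.stubS2sharpTheta_holds`, FAM-TR ↦ ★ p842415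
  `F0P2rFamTransferHolds.stubRelFamTransfer_holds`, CUSP-DICT ↦ ★ p842892 `F0P2rCuspDictHolds.stubCuspDict_holds` BY NAME and the Lines-local `CuspLabel` spelled out.
  DAY-X USE: when P3 lands `relSharpOne_holds : ‹REL♯¹›` (one token over the closer's rows, `F0P3KitOfRecord.relSharpOneMeasure_of_rows`), `relOne_of_relSharpOne relSharpOne_holds`
  is REL¹ at Theorems level — the by-name fold of E1 `stub_E3flatRel1` AND the input of `F0P2vE3FlatOfRelOne.e3flat_of_relOne` (no E2 → E1 Lines import, O50-1).

## References
* [Rogawski1990] J. Rogawski, *Automorphic representations of unitary groups in three variables*, Ann. of Math. Stud. 123 (1990): Thm. 13.3.5, 13.3.6 (c), Prop. 13.1.3 (d), Thm. 14.6.4 p. 243, Prop. 15.2.1.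
* [Rogawski1992] J. Rogawski, *The multiplicity formula for A-packets*, in: The zeta functions of Picard modular surfaces (1992), Thm. 1.1.
* [GelbartRogawski1991] S. Gelbart, J. Rogawski, *L-functions and Fourier–Jacobi coefficients for the unitary group U(3)*, Invent. Math. 105 (1991): Lem. 5.1.2 p. 466, Thm. 5.1.1.
* [Liu2021] Y. Liu, *Fourier–Jacobi cycles and arithmetic relative trace formula*, Camb. J. Math. 9 (2021): Prop. 4.13 (proof l. 2121–2149), Def. 4.11–4.12, Rem. 4.14.
* [Omeara1963] O. T. O'Meara, *Introduction to quadratic forms* (1963), §71 Thm. 71:18 (Hilbert reciprocity).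
-/

set_option autoImplicit false

-- the mandated namespace has the single-problem summit's repeated segment (`HodgeConjecture.HodgeConjecture`)
set_option linter.dupNamespace false

noncomputable section

namespace Summit.HodgeConjecture.HodgeConjecture.Cruxes.H413.F0P2vRelOneOfRelSharpOne

open scoped Matrix ComplexOrder
open NumberField NumberField.InfinitePlace IsDedekindDomain MeasureTheory
open Literature.NumberTheory Literature.NumberTheory.Automorphic Literature.NumberTheory.Automorphic.UnitaryGroup
open Literature.NumberTheory.Automorphic.UnitaryGroup.CotangentForms
open Literature.NumberTheory.Automorphic.Liu2021 Literature.NumberTheory.Automorphic.Liu2021.AppendixC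
open Literature.NumberTheory.Automorphic.Liu2021.Def411WeilCarriers
open Literature.NumberTheory.Automorphic.Liu2021.Def411WeilCarriersDoubling
open Literature.NumberTheory.Automorphic.IdeleClassGroup
open Literature.NumberTheory.GelbartRogawski1991 Literature.NumberTheory.GelbartRogawski1991.UnitaryDualPair
open Literature.NumberTheory.GelbartRogawski1991.UnitaryDualPair.WeilCoinv
open Literature.RepresentationTheory Literature.RepresentationTheory.Liu2021
open Literature.NumberTheory.GaloisRepresentations
open Literature.NumberTheory.Rogawski1990
open Summit.HodgeConjecture.CorCM
open Summit.HodgeConjecture.CorCM.Transposition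
open Summit.HodgeConjecture.HodgeConjecture.Cruxes.H413.F0P3MemXiFamilyTransfer

set_option synthInstance.maxHeartbeats 400000 in
set_option maxHeartbeats 8000000 in
/-- **REL¹ ⟸ REL♯¹** (E2 `relParity_of_engine` re-hosted; S2♯-θ ★, FAM-TR ★, CUSP-DICT ★ by name): Rogawski's `μω` (★ `exists_muOmega`); S2♯-θ puts `P`, `P′` in the
ξ-, ξ′-local families; FAM-TR moves `P′` into the ξ-family; REL♯¹ gives the even symmetric difference of the supercuspidal label sets; CUSP-DICT identifies that set
with `{v ∣ [a]_v ≠ [a′]_v}`.  [cite: Rogawski1990, Thm. 14.6.4 p. 243, Prop. 13.1.3 (d) p. 199] [cite: GelbartRogawski1991, Lem. 5.1.2 p. 466] [cite: Liu2021, Prop. 4.13, Def. 4.11] -/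
theorem relOne_of_relSharpOne
    (hRS :
        ∀ (L : Type) [Field L] [NumberField L] [IsCMField L] (ι : L →+* ℂ) (H : Matrix (Fin 3) (Fin 3) L) (T : GL (Fin 3) ℂ)
          (hT : (T : Matrix (Fin 3) (Fin 3) ℂ)ᴴ * H.map ι * (T : Matrix (Fin 3) (Fin 3) ℂ) = Literature.Geometry.ComplexHyperbolic.BallModel.J),
          (∀ τ' : L →+* ℂ, InfinitePlace.mk τ' ≠ InfinitePlace.mk ι → (H.map τ').PosDef) → 2 ≤ Module.finrank ℚ ↥(maximalRealSubfield L) →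
            ∀ (μA : Measure (adelicGroupData (↥(maximalRealSubfield L)) L (IsCMField.complexConj L) 3 H).automorphicQuotient)
              [(adelicGroupData (↥(maximalRealSubfield L)) L (IsCMField.complexConj L) 3 H).IsAutomorphicMeasure μA]
              (P P' : DiscreteAutomorphicRep (adelicGroupData (↥(maximalRealSubfield L)) L (IsCMField.complexConj L) 3 H) μA),
              (P.IsHolCotangentAt (cmArchSection L ι H T hT) (cmCompactFactor L ι H T hT) ∨ P.IsAntiholCotangentAt (cmArchSection L ι H T hT) (cmCompactFactor L ι H T hT)) →
              (P'.IsHolCotangentAt (cmArchSection L ι H T hT) (cmCompactFactor L ι H T hT) ∨ P'.IsAntiholCotangentAt (cmArchSection L ι H T hT) (cmCompactFactor L ι H T hT)) →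
              ∀ (μω : HeckeCharacter L) (hμu : μω.IsUnitary),
                (∀ x : Literature.NumberTheory.GaloisRepresentations.ideleGroup ↥(maximalRealSubfield L),
                  μω (AdeleRing.ideleBaseChange (↥(maximalRealSubfield L)) L x) = quadraticHeckeCharCM L x) →
              ∀ (ξ : OneDimAutRepH L),
                MemXiFamily P (transpose_map_cmConjRingHom_eq_of_frame L ι H T hT) (isUnit_det_of_frame L ι H T hT) μω hμu ξ →
                MemXiFamily P' (transpose_map_cmConjRingHom_eq_of_frame L ι H T hT) (isUnit_det_of_frame L ι H T hT) μω hμu ξ →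
                  Even ({v : HeightOneSpectrum (𝓞 ↥(maximalRealSubfield L)) | ¬ ((∃ c : IrrClass ((cmDatum L 3 H).Local v),
                      (IrrClass.comap (localPiEquiv L (IsCMField.complexConj L) 3 H v) c).IsConstituentOf
                          (P.finRep.smoothPart.toRepresentation.comp (inclPlace (↥(maximalRealSubfield L)) L (IsCMField.complexConj L) 3 H v)) ∧
                        c.IsSupercuspidal) ↔
                    (∃ c : IrrClass ((cmDatum L 3 H).Local v),
                      (IrrClass.comap (localPiEquiv L (IsCMField.complexConj L) 3 H v) c).IsConstituentOf
                          (P'.finRep.smoothPart.toRepresentation.comp (inclPlace (↥(maximalRealSubfield L)) L (IsCMField.complexConj L) 3 H v)) ∧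
                        c.IsSupercuspidal))}.ncard)
    ) :
    ∀ (L : Type) [Field L] [NumberField L] [IsCMField L] (ι : L →+* ℂ) (H : Matrix (Fin 3) (Fin 3) L) (T : GL (Fin 3) ℂ)
      (hT : (T : Matrix (Fin 3) (Fin 3) ℂ)ᴴ * H.map ι * (T : Matrix (Fin 3) (Fin 3) ℂ) = Literature.Geometry.ComplexHyperbolic.BallModel.J),
      (∀ τ' : L →+* ℂ, InfinitePlace.mk τ' ≠ InfinitePlace.mk ι → (H.map τ').PosDef) → 2 ≤ Module.finrank ℚ ↥(maximalRealSubfield L) →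
      ∀ {n' : ℕ} (e₁ : Fin 3 × Fin 1 ≃ Fin n') (dV : Fin 3 → L) (hdV : ∀ i, IsCMField.complexConj L (dV i) = dV i)
        (hdV0 : ∀ i, dV i ≠ 0) (g : GL (Fin 3) L)
        (hg : ((g : Matrix (Fin 3) (Fin 3) L).map (cmConjRingHom L))ᵀ * H * (g : Matrix (Fin 3) (Fin 3) L) = Matrix.diagonal dV)
        (ιV : finAdelic (↥(maximalRealSubfield L)) L (IsCMField.complexConj L) 3 H →*
            finAdelic (↥(maximalRealSubfield L)) L (IsCMField.complexConj L) 3 (Matrix.diagonal dV)),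
          (∀ k, ((ιV k : finAdelic (↥(maximalRealSubfield L)) L (IsCMField.complexConj L) 3 (Matrix.diagonal dV)) :
              GL (Fin 3) (FiniteAdeleRing (𝓞 L) L)) =
            (toFinAdeleGL L 3 g)⁻¹ * (k : GL (Fin 3) (FiniteAdeleRing (𝓞 L) L)) * toFinAdeleGL L 3 g) →
          ∀ (μA : Measure (adelicGroupData (↥(maximalRealSubfield L)) L (IsCMField.complexConj L) 3 H).automorphicQuotient)
            [(adelicGroupData (↥(maximalRealSubfield L)) L (IsCMField.complexConj L) 3 H).IsAutomorphicMeasure μA]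
            (P : DiscreteAutomorphicRep (adelicGroupData (↥(maximalRealSubfield L)) L (IsCMField.complexConj L) 3 H) μA)
            (P' : DiscreteAutomorphicRep (adelicGroupData (↥(maximalRealSubfield L)) L (IsCMField.complexConj L) 3 H) μA),
            (P.IsHolCotangentAt (cmArchSection L ι H T hT) (cmCompactFactor L ι H T hT) ∨ P.IsAntiholCotangentAt (cmArchSection L ι H T hT) (cmCompactFactor L ι H T hT)) →
            (P'.IsHolCotangentAt (cmArchSection L ι H T hT) (cmCompactFactor L ι H T hT) ∨ P'.IsAntiholCotangentAt (cmArchSection L ι H T hT) (cmCompactFactor L ι H T hT)) →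
              ∀ (μ : Literature.NumberTheory.Automorphic.IdeleClassGroup L →ₜ* Circle) (hμ : IsConjugateSymplectic L μ), HasWeight L μ 1 →
                ∀ (a a' : (↥(maximalRealSubfield L))ˣ) (χ : Chi (↥(maximalRealSubfield L)) L (IsCMField.complexConj L)),
                  P.HasFinComponent
                    (rhoAtLine (↥(maximalRealSubfield L)) L (IsCMField.complexConj L) 3 e₁ (Matrix.diagonal dV)
                      (complexConj_imagUnit L) (imagUnit_ne_zero L) (imagUnit_mul_self L) (realDiagonal_isSymm L dV hdV)
                      (isUnit_det_realDiagonal L dV hdV hdV0) (realDiagonal_map L dV hdV).symm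
                      (fun a => isCompatible_chiSplittingLine L e₁ dV hdV hdV0 (toHeckeCharacter L μ)
                        (isUnitary_toHeckeCharacter L μ) ((isOscillatorChar_toHeckeCharacter_iff μ).mpr hμ)
                        (TW (↥(maximalRealSubfield L)) a) (isSymm_TW (↥(maximalRealSubfield L)) a)
                        (isUnit_det_TW (↥(maximalRealSubfield L)) a) (JW (↥(maximalRealSubfield L)) L a)
                        (JW_eq (↥(maximalRealSubfield L)) L a)) ιV a χ) →
                  P'.HasFinComponent
                    (rhoAtLine (↥(maximalRealSubfield L)) L (IsCMField.complexConj L) 3 e₁ (Matrix.diagonal dV)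
                      (complexConj_imagUnit L) (imagUnit_ne_zero L) (imagUnit_mul_self L) (realDiagonal_isSymm L dV hdV)
                      (isUnit_det_realDiagonal L dV hdV hdV0) (realDiagonal_map L dV hdV).symm
                      (fun a => isCompatible_chiSplittingLine L e₁ dV hdV hdV0 (toHeckeCharacter L μ)
                        (isUnitary_toHeckeCharacter L μ) ((isOscillatorChar_toHeckeCharacter_iff μ).mpr hμ)
                        (TW (↥(maximalRealSubfield L)) a) (isSymm_TW (↥(maximalRealSubfield L)) a)
                        (isUnit_det_TW (↥(maximalRealSubfield L)) a) (JW (↥(maximalRealSubfield L)) L a)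
                        (JW_eq (↥(maximalRealSubfield L)) L a)) ιV a' χ) →
                    Even ({v : HeightOneSpectrum (𝓞 ↥(maximalRealSubfield L)) |
                            locF (↥(maximalRealSubfield L)) (imagUnitSq L) a v ≠ locF (↥(maximalRealSubfield L)) (imagUnitSq L) a' v}.ncard) := by
  intro L _ _ _ ι H T hT hdef h2 n' e₁ dV hdV hdV0 g hg ιV hιV μA _ P P' hP hP' μ hμ hw a a' χ hfin hfin'
  obtain ⟨μω, hμu, hquad⟩ := exists_muOmega L
  -- S2♯-θ for `P` and for `P′` (ED. 4: fed by the theta finite components; no `(𝔤,K)`-token, no `Kc`-binder)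
  obtain ⟨ξ, hmem⟩ := Summit.HodgeConjecture.HodgeConjecture.Cruxes.H413.F0P2uS2SharpTheta.stubS2sharpTheta_holds L ι H T hT hdef h2 e₁ dV hdV hdV0 g hg ιV hιV μA P μω hμu hquad μ hμ hw a χ hfin
  obtain ⟨ξ', hmem'⟩ := Summit.HodgeConjecture.HodgeConjecture.Cruxes.H413.F0P2uS2SharpTheta.stubS2sharpTheta_holds L ι H T hT hdef h2 e₁ dV hdV hdV0 g hg ιV hιV μA P' μω hμu hquad μ hμ hw a' χ hfin'
  -- FAM-TR: `P′` lies in the ξ-local family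
  have hmemP' := Summit.HodgeConjecture.HodgeConjecture.Cruxes.H413.F0P2rFamTransferHolds.stubRelFamTransfer_holds L ι H T hT e₁ dV hdV hdV0 g hg ιV hιV μA μA P P' μω hμu hquad ξ ξ' hmem hmem' μ hμ hw a a' χ hfin hfin'
  -- REL♯¹ (one measure): even symmetric difference of the supercuspidal label sets (the supercuspidal label spelled out, as in the REL♯¹ text)
  have hpar := hRS L ι H T hT hdef h2 μA P P' hP hP' μω hμu hquad ξ hmem hmemP'
  -- CUSP-DICT: the label sets differ exactly where the norm classes of `a`, `a′` differ
  have hdict := Summit.HodgeConjecture.HodgeConjecture.Cruxes.H413.F0P2rCuspDictHolds.stubCuspDict_holds L H e₁ dV hdV hdV0 g hg ιV hιV μA μA P P' μ hμ hw a a' χ hfin hfin'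
  have hset :
      {v : HeightOneSpectrum (𝓞 ↥(maximalRealSubfield L)) |
          locF (↥(maximalRealSubfield L)) (imagUnitSq L) a v ≠ locF (↥(maximalRealSubfield L)) (imagUnitSq L) a' v} =
        {v : HeightOneSpectrum (𝓞 ↥(maximalRealSubfield L)) | ¬ ((∃ c : IrrClass ((cmDatum L 3 H).Local v),
                  (IrrClass.comap (localPiEquiv L (IsCMField.complexConj L) 3 H v) c).IsConstituentOf
                      (P.finRep.smoothPart.toRepresentation.comp (inclPlace (↥(maximalRealSubfield L)) L (IsCMField.complexConj L) 3 H v)) ∧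
                    c.IsSupercuspidal) ↔
                (∃ c : IrrClass ((cmDatum L 3 H).Local v),
                  (IrrClass.comap (localPiEquiv L (IsCMField.complexConj L) 3 H v) c).IsConstituentOf
                      (P'.finRep.smoothPart.toRepresentation.comp (inclPlace (↥(maximalRealSubfield L)) L (IsCMField.complexConj L) 3 H v)) ∧
                    c.IsSupercuspidal))} := by
    ext v
    simp only [Set.mem_setOf_eq, ne_eq]
    exact (not_congr (hdict v)).symm
  rw [hset]
  exact hpar

end Summit.HodgeConjecture.HodgeConjecture.Cruxes.H413.F0P2vRelOneOfRelSharpOne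

end
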